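import Mathlib
import Summits.KontsevichZagierPeriods.KontsevichZagierPeriods.Theorems.TorsionLogsGKZLevelThreePairLogTail
import Literature.NumberTheory.Transcendental.SemialgebraicRpow
import Summits.KontsevichZagierPeriods.KontsevichZagierPeriods.Theorems.TorsionLogsGKZLevelThreePairTChainSubst

/-!
# Route TorsionLogs — support item `GKZLevelThreePair`: the T-chain, step (N4)
# (`[(0,1), 3(m^{-1/3} - m^{1/3})/√(1-s²)] ∼ [(0,1), 9(1-r)/(1+r³)]`, `m = (1-√(1-s²))/s`)

Helper file for item `stmt-KontsevichZagierPeriods-13812` (`GKZLevelThreePair`), blueprint v3: after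
the cube-root chart `x³ = (1-t)/(t(1-y²t))` of the hyperelliptic model `Y² = x⁶ + 2(1-2y²)x³ + 1`,
the affine chart `y = s(x³+1)/(2x√x)` and ONE Newton–Leibniz move in `x`, the factor
`Trep` (value `T = 6 log 2`) of the level-3 Euler representation becomes the one-dimensional
representation `R4 = [(0,1), 3(m(s)^{-1/3} - m(s)^{1/3})/√(1-s²)]`, `m(s) = (1 - √(1-s²))/s`. Here:

* `tail5_equivalent_tail4` — ONE change of variables `s = φ(r) = 2r√r/(1+r³)` from `(0,1)` onto
  `(0,1)` (rule 2)): with `r = q²`, `φ = 2q³/(1+q⁶)`, `√(1-φ²) = (1-q⁶)/(1+q⁶)`, `m(φ) = q³`,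
  `φ' = 3q(1-q⁶)/(1+q⁶)²` (`tailSubst_data`, `hasDerivAt_tailSubst`), so that the pull-back of `R4`
  is `R5 = [(0,1), 9(1-r)/(1+r³)]`;
* `exists_tail4` — `R4` exists (its integrand is `ℚ`-semialgebraic; its integrability is
  transported from the bounded `R5` along `φ` by Mathlib's change-of-variables criterion).

`R5 ∼ [(1,2), 6/x]` is `tail5_equivalent_L6` (`…TChainTail5.lean`).

## References

* M. Kontsevich, D. Zagier, *Periods* (2001), §1.2 rule (2).
-/

-- `Summit.<Summit>.<Sub>` with Sub = Summit (single-conjunct summit, D-0017) duplicates the segment.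
set_option linter.dupNamespace false

noncomputable section

namespace Summit.KontsevichZagierPeriods.KontsevichZagierPeriods.Theorems.GKZLevelThree

open Set MeasureTheory
open MvPolynomial (aeval X C)
open Literature.NumberTheory.Transcendental Literature.NumberTheory.Transcendental.KZ
open Literature.ModelTheory.ExponentialFields (IsSemialgebraic isSemialgebraic_setOf_eval_pos)
open Summit.KontsevichZagierPeriods.HermiteRigidity.CMTwistQuasiPeriodTransfer
  (of_sub_of_mem_changeOfVariablesRel_dimOne)
open Summit.KontsevichZagierPeriods.HermiteRigidity.GenusTwoCycleTransfer
  (hasFDerivAt_fin_one det_smul_id_fin_one)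

/-- **Step (N4)**: `R5 = [(0,1), 9(1-r)/(1+r³)] ∼ R4 = [(0,1), 3(m^{-1/3} - m^{1/3})/√(1-s²)]`,
`m = (1-√(1-s²))/s`, by ONE change of variables `s = 2r√r/(1+r³)` (rule 2); `tailSubst_data`).
[Kontsevich–Zagier 2001, §1.2 rule (2)] -/
theorem tail5_equivalent_tail4 (R₅ R₄ : IntegralRep 1)
    (h5d : R₅.domain = {x : Fin 1 → ℝ | 0 < x 0 ∧ x 0 < 1})
    (h5i : EqOn R₅.integrand (fun x => 9 * (1 - x 0) / (1 + x 0 ^ 3)) R₅.domain)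
    (h4d : R₄.domain = {x : Fin 1 → ℝ | 0 < x 0 ∧ x 0 < 1})
    (h4i : EqOn R₄.integrand (fun x => 3 * (((1 - Real.sqrt (1 - x 0 ^ 2)) / x 0) ^ (-(1:ℝ) / 3) -
      ((1 - Real.sqrt (1 - x 0 ^ 2)) / x 0) ^ ((1:ℝ) / 3)) / Real.sqrt (1 - x 0 ^ 2)) R₄.domain) :
    Equivalent R₅ R₄ := by
  set φ : ℝ → ℝ := fun r => 2 * (r * Real.sqrt r) / (1 + r ^ 3) with hφ
  set φ' : ℝ → ℝ := fun r => 3 * Real.sqrt r * (1 - r ^ 3) / (1 + r ^ 3) ^ 2 with hφ'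
  refine changeOfVariablesRel_subset_relations
    (of_sub_of_mem_changeOfVariablesRel_dimOne R₅ R₄ φ φ' ?_ ?_ ?_ ?_ ?_)
  · exact isSemialgebraicFunOn_tailSubst R₅.isSemialgebraic_domain fun p hp => by
      rw [h5d] at hp; exact hp.1.le
  · intro p hp
    have hp' : 0 < p 0 ∧ p 0 < 1 := by rw [h5d] at hp; exact hp
    set q := Real.sqrt (p 0) with hq
    have hq0 : 0 < q := Real.sqrt_pos.2 hp'.1
    have hr2 : p 0 = q ^ 2 := (Real.sq_sqrt hp'.1.le).symm
    have h := hasDerivAt_tailSubst hq0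
    rw [← hr2] at h
    refine h.congr_deriv ?_
    simp only [hφ']
    rw [hr2, Real.sqrt_sq hq0.le]
    ring
  · intro p hp q hq h
    rw [h5d] at hp hq
    exact strictMonoOn_tailSubst.injOn (Ioo_subset_Icc_self hp) (Ioo_subset_Icc_self hq) h
  · rw [h4d, h5d]
    ext y
    simp only [mem_setOf_eq, mem_image]
    constructor
    · intro hy
      have : y 0 ∈ φ '' Ioo 0 1 := by rw [image_tailSubst]; exact hy
      obtain ⟨w, hw, hwy⟩ := this
      exact ⟨fun _ => w, hw, funext fun i => by rw [Subsingleton.elim i 0]; exact hwy⟩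
    · rintro ⟨p, hp, rfl⟩
      have : φ (p 0) ∈ φ '' Ioo 0 1 := mem_image_of_mem φ hp
      rwa [image_tailSubst] at this
  · intro p hp
    have hp' : 0 < p 0 ∧ p 0 < 1 := by rw [h5d] at hp; exact hp
    set q := Real.sqrt (p 0) with hq
    have hq0 : 0 < q := Real.sqrt_pos.2 hp'.1
    have hq1 : q < 1 := (Real.sqrt_lt' one_pos).2 (by simpa using hp'.2)
    have hr2 : p 0 = q ^ 2 := (Real.sq_sqrt hp'.1.le).symm
    obtain ⟨hs0, hs1, hsqrt, hm, hpull⟩ := tailSubst_data hq0 hq1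
    have hφq : φ (p 0) = 2 * (q ^ 2 * q) / (1 + (q ^ 2) ^ 3) := by
      simp only [hφ]; rw [hr2, Real.sqrt_sq hq0.le]
    have hmem : (fun _ : Fin 1 => φ (p 0)) ∈ R₄.domain := by
      rw [h4d]; exact ⟨by rw [hφq]; exact hs0, by rw [hφq]; exact hs1⟩
    have hφ'q : φ' (p 0) = 3 * q * (1 - q ^ 6) / (1 + q ^ 6) ^ 2 := by
      simp only [hφ']; rw [hr2, Real.sqrt_sq hq0.le]; ring
    have hpos : 0 < φ' (p 0) := by
      rw [hφ'q]
      have : q ^ 6 < 1 := by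
        calc q ^ 6 < 1 ^ 6 := pow_lt_pow_left₀ hq1 hq0.le (by norm_num)
          _ = 1 := one_pow 6
      have h' : 0 < 1 - q ^ 6 := by linarith
      positivity
    rw [h5i hp, h4i hmem, abs_of_pos hpos]
    show 9 * (1 - p 0) / (1 + p 0 ^ 3) = 3 * (((1 - Real.sqrt (1 - φ (p 0) ^ 2)) / φ (p 0)) ^ (-(1:ℝ) / 3) -
      ((1 - Real.sqrt (1 - φ (p 0) ^ 2)) / φ (p 0)) ^ ((1:ℝ) / 3)) / Real.sqrt (1 - φ (p 0) ^ 2) * φ' (p 0)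
    rw [hφq, hm, hsqrt, hφ'q, hpull, hr2]

/-- **`R4` exists**: the representation `[(0,1), 3(m^{-1/3} - m^{1/3})/√(1-s²)]` (its integrand is
`ℚ`-semialgebraic: square roots and cube roots of positive semialgebraic functions; it is absolutely
integrable because its pull-back along the substitution of `tail5_equivalent_tail4` is the bounded
function `9(1-r)/(1+r³)` — Mathlib's change-of-variables criterion for integrability). -/
theorem exists_tail4 : ∃ R₄ : IntegralRep 1, R₄.domain = {x : Fin 1 → ℝ | 0 < x 0 ∧ x 0 < 1} ∧
    R₄.integrand = fun x => 3 * (((1 - Real.sqrt (1 - x 0 ^ 2)) / x 0) ^ (-(1:ℝ) / 3) -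
      ((1 - Real.sqrt (1 - x 0 ^ 2)) / x 0) ^ ((1:ℝ) / 3)) / Real.sqrt (1 - x 0 ^ 2) := by
  set D : Set (Fin 1 → ℝ) := {x | 0 < x 0 ∧ x 0 < 1} with hD
  have hDs : IsSemialgebraic ℚ D :=
    (KZ.isSemialgebraic_setOf_const_lt_apply isAlgebraic_zero 0).inter
      (KZ.isSemialgebraic_setOf_apply_lt_const isAlgebraic_one 0)
  set g : (Fin 1 → ℝ) → ℝ := fun x => 3 * (((1 - Real.sqrt (1 - x 0 ^ 2)) / x 0) ^ (-(1:ℝ) / 3) -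
      ((1 - Real.sqrt (1 - x 0 ^ 2)) / x 0) ^ ((1:ℝ) / 3)) / Real.sqrt (1 - x 0 ^ 2) with hg
  -- semialgebraicity
  have hX : IsSemialgebraicFunOn ℚ D (fun p => p 0) :=
    (isSemialgebraicFunOn_aeval hDs (X 0 : MvPolynomial (Fin 1) ℚ)).congr fun z _ => by simp
  have h1s : IsSemialgebraicFunOn ℚ D (fun p => 1 - p 0 ^ 2) :=
    (isSemialgebraicFunOn_aeval hDs (1 - X 0 ^ 2 : MvPolynomial (Fin 1) ℚ)).congr fun z _ => by simp
  have hsq : IsSemialgebraicFunOn ℚ D (fun p => Real.sqrt (1 - p 0 ^ 2)) := IsSemialgebraicFunOn.sqrt_holds h1s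
  have hone : IsSemialgebraicFunOn ℚ D (fun _ => (1:ℝ)) := by
    simpa using isSemialgebraicFunOn_const_of_isAlgebraic hDs isAlgebraic_one
  have hm : IsSemialgebraicFunOn ℚ D (fun p => (1 - Real.sqrt (1 - p 0 ^ 2)) / p 0) :=
    (IsSemialgebraicFunOn.sub_holds hone hsq).div hX fun p hp => hp.1.ne'
  have hsqlt : ∀ p ∈ D, Real.sqrt (1 - p 0 ^ 2) < 1 := fun p hp => by
    rw [Real.sqrt_lt' one_pos]
    nlinarith [hp.1]
  have hmpos : ∀ p ∈ D, 0 < (1 - Real.sqrt (1 - p 0 ^ 2)) / p 0 := fun p hp =>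
    div_pos (by linarith [hsqlt p hp]) hp.1
  have hA : IsSemialgebraicFunOn ℚ D (fun p => ((1 - Real.sqrt (1 - p 0 ^ 2)) / p 0) ^ (((-1 / 3 : ℚ) : ℚ) : ℝ)) :=
    hm.rpow_ratCast hDs hmpos (-1 / 3)
  have hB : IsSemialgebraicFunOn ℚ D (fun p => ((1 - Real.sqrt (1 - p 0 ^ 2)) / p 0) ^ (((1 / 3 : ℚ) : ℚ) : ℝ)) :=
    hm.rpow_ratCast hDs hmpos (1 / 3)
  have h3 : IsSemialgebraicFunOn ℚ D (fun _ => (3:ℝ)) := by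
    simpa using isSemialgebraicFunOn_const_of_isAlgebraic hDs (isAlgebraic_nat (R := ℚ) (A := ℝ) 3)
  have hsqpos : ∀ p ∈ D, 0 < Real.sqrt (1 - p 0 ^ 2) := fun p hp => Real.sqrt_pos.2 (by nlinarith [hp.1, hp.2])
  have hgs : IsSemialgebraicFunOn ℚ D g := by
    refine ((IsSemialgebraicFunOn.mul_holds h3 (IsSemialgebraicFunOn.sub_holds hA hB)).div hsq
      fun p hp => (hsqpos p hp).ne').congr fun p _ => ?_
    simp only [hg, Pi.mul_apply, Pi.sub_apply]
    norm_num
  -- integrability, transported along `φ`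
  set φ : ℝ → ℝ := fun r => 2 * (r * Real.sqrt r) / (1 + r ^ 3) with hφ
  set φ' : ℝ → ℝ := fun r => 3 * Real.sqrt r * (1 - r ^ 3) / (1 + r ^ 3) ^ 2 with hφ'
  set Φ : (Fin 1 → ℝ) → (Fin 1 → ℝ) := fun p _ => φ (p 0) with hΦ
  have hmeas : MeasurableSet D := by
    have : D = (fun x : Fin 1 → ℝ => x 0) ⁻¹' Ioo 0 1 := by
      ext x; simp [hD, mem_Ioo]
    rw [this]
    exact measurableSet_Ioo.preimage (measurable_pi_apply 0)
  have hderiv : ∀ p ∈ D, HasFDerivWithinAt Φ (φ' (p 0) • ContinuousLinearMap.id ℝ (Fin 1 → ℝ)) D p := by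
    intro p hp
    set q := Real.sqrt (p 0) with hq
    have hq0 : 0 < q := Real.sqrt_pos.2 hp.1
    have hr2 : p 0 = q ^ 2 := (Real.sq_sqrt hp.1.le).symm
    have h := hasDerivAt_tailSubst hq0
    rw [← hr2] at h
    have h' : HasDerivAt φ (φ' (p 0)) (p 0) := by
      refine h.congr_deriv ?_
      simp only [hφ']
      rw [hr2, Real.sqrt_sq hq0.le]
      ring
    exact (hasFDerivAt_fin_one φ (φ' (p 0)) p h').hasFDerivWithinAt
  have hinj : InjOn Φ D := by
    intro p hp q hq h
    have h0 := strictMonoOn_tailSubst.injOn (Ioo_subset_Icc_self hp) (Ioo_subset_Icc_self hq) (congrFun h 0)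
    funext i; rw [Subsingleton.elim i 0]; exact h0
  have himage : Φ '' D = D := by
    ext y
    simp only [mem_image, hD, mem_setOf_eq]
    constructor
    · rintro ⟨p, hp, rfl⟩
      have : φ (p 0) ∈ φ '' Ioo 0 1 := mem_image_of_mem φ hp
      rwa [image_tailSubst] at this
    · intro hy
      have : y 0 ∈ φ '' Ioo 0 1 := by rw [image_tailSubst]; exact hy
      obtain ⟨w, hw, hwy⟩ := this
      exact ⟨fun _ => w, hw, funext fun i => by rw [Subsingleton.elim i 0]; exact hwy⟩
  obtain ⟨R₅, h5d, h5i⟩ := exists_ratRep01 (C 9 * (1 - X 0)) (1 + X 0 ^ 3) (fun r => 9 * (1 - r) / (1 + r ^ 3))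
    (fun r hr => by
      simp only [map_add, map_one, map_pow, MvPolynomial.aeval_X, ne_eq]
      exact one_add_cube_ne_zero hr.1)
    (fun r => by simp)
    ((by fun_prop : Continuous fun r : ℝ => 9 * (1 - r)).continuousOn.div (by fun_prop)
      fun r hr => one_add_cube_ne_zero hr.1)
  have hint : IntegrableOn g D := by
    rw [← himage, integrableOn_image_iff_integrableOn_abs_det_fderiv_smul volume hmeas hderiv hinj g]
    have h5int : IntegrableOn R₅.integrand D := by
      have h := R₅.integrableOn
      rwa [h5d] at h
    refine h5int.congr_fun (fun p hp => ?_) hmeas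
    rw [h5i, det_smul_id_fin_one, smul_eq_mul]
    set q := Real.sqrt (p 0) with hq
    have hq0 : 0 < q := Real.sqrt_pos.2 hp.1
    have hq1 : q < 1 := (Real.sqrt_lt' one_pos).2 (by simpa using hp.2)
    have hr2 : p 0 = q ^ 2 := (Real.sq_sqrt hp.1.le).symm
    obtain ⟨hs0, hs1, hsqrt, hm', hpull⟩ := tailSubst_data hq0 hq1
    have hφq : φ (p 0) = 2 * (q ^ 2 * q) / (1 + (q ^ 2) ^ 3) := by
      simp only [hφ]; rw [hr2, Real.sqrt_sq hq0.le]
    have hφ'q : φ' (p 0) = 3 * q * (1 - q ^ 6) / (1 + q ^ 6) ^ 2 := by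
      simp only [hφ']; rw [hr2, Real.sqrt_sq hq0.le]; ring
    have hpos : 0 < φ' (p 0) := by
      rw [hφ'q]
      have : q ^ 6 < 1 := by
        calc q ^ 6 < 1 ^ 6 := pow_lt_pow_left₀ hq1 hq0.le (by norm_num)
          _ = 1 := one_pow 6
      have h' : 0 < 1 - q ^ 6 := by linarith
      positivity
    show 9 * (1 - p 0) / (1 + p 0 ^ 3) = |φ' (p 0)| * g (fun _ => φ (p 0))
    rw [abs_of_pos hpos]
    simp only [hg]
    rw [hφq, hm', hsqrt, hφ'q, hr2, ← hpull]
    ring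
  exact ⟨⟨D, g, hDs, hgs, hint⟩, rfl, rfl⟩

end Summit.KontsevichZagierPeriods.KontsevichZagierPeriods.Theorems.GKZLevelThree

end
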